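import Summits.AtomisticToContinuum.FouriersLaw.Theorems.VanishingNoiseTransferNoisyFourierFlipResolventDefect
import Summits.AtomisticToContinuum.FouriersLaw.Theorems.VanishingNoiseTransferNoisyFourierFlipResolventDuhamel
import Literature.Analysis.FluidPDE.KochTataruFixedPoint

/-!
# Resolvent identification of weak flip steady states, part 6: the setwise resolvent inequality (reversed side)

Helper file for crux `NoisyFourier` (stmt-AtomisticToContinuum-11977, route `VanishingNoiseTransfer`), line
`sector-dirichlet-gluing`, registered stub `stub_flipSteadyState_eq_bind_resolventKernel`. For a chain with smooth
confining potentials, `N ≥ 1`, `T_L, T_R ≥ 0`, polynomial volume growth of the energy sublevel sets, and a `C²`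
integrable `ρ ≥ 0` solving `L̂ρ + cρ + g = 0` with a continuous integrable source `g ≥ 0`:

* `exists_truncationFamily_src` — the truncations `f_n ∈ C²_c` of part 4 packaged as sequences: `0 ≤ f_n ≤ ρ`,
  `f_n → ρ`, sources `g_n = χ(H/R_n)χ(ρ/M_n) g ∈ [0, g]`, `g_n → g`, defects `E_n = L̂ f_n + c f_n + g_n` with
  `‖E_n‖₁ ≤ 1/(n+1)`;
* `duhamel_split_src` — Duhamel with rate `c` (part 5): `e^{ct}P̂_t f + ∫₀ᵗ e^{cs}P̂_s g' = f + ∫₀ᵗ e^{cs}P̂_s (L̂f+cf+g')`;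
* `setLIntegral_revKernel_density_add_le_src` — **for `t > 0` and every set `A`,
  `e^{ct} ∫_A P̂_t ρ dy + ∫_A (∫₀ᵗ ∫ e^{cs} g dP̂_s ds) dy ≤ ∫_A ρ dy`** (integrate Duhamel over `A`, bound the
  defect term by `e^{|c|t} t ‖E_n‖₁`, Fatou's lemma in both terms on the left; superadditivity of `liminf` from
  `Literature.Analysis.FluidPDE.liminf_add_liminf_le_liminf_add`).

This is the `ε > 0` replacement of `NessUnique.setLIntegral_revKernel_density_le` (`c = 2γ`, `g = 0`). No definitions.
-/

noncomputable section

open MeasureTheory ProbabilityTheory Filter Topology Set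
open scoped NNReal ENNReal ContDiff

namespace Summit.AtomisticToContinuum.FouriersLaw.Theorems.NoisyFourier.FlipResolvent

open Literature.MathematicalPhysics.KineticTheory.HeatConduction
open Literature.MathematicalPhysics.KineticTheory Literature.Probability.Process OscillatorChain
open Summit.AtomisticToContinuum.FouriersLaw.Theorems.SubdiffusiveBondHeat
open Summit.AtomisticToContinuum.FouriersLaw.Theorems.NessUnique

variable {N : ℕ} {P : OscillatorChain}

section Setwise

variable (hU : ContDiff ℝ ((⊤ : ℕ∞) : WithTop ℕ∞) P.U)
  (hV : ContDiff ℝ ((⊤ : ℕ∞) : WithTop ℕ∞) P.V) (hN : 0 < N) {T_L T_R : ℝ} (hTL : 0 ≤ T_L) (hTR : 0 ≤ T_R)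
  {ρ : PhaseSpace N → ℝ} (hρ : ContDiff ℝ 2 ρ) (hρ0 : ∀ x, 0 ≤ ρ x) (hρi : Integrable ρ)
  {c : ℝ} {g : PhaseSpace N → ℝ} (hg : Continuous g) (hg0 : ∀ x, 0 ≤ g x) (hgi : Integrable g)
  (hpde : ∀ x, sdeGenerator (fun y => -P.drift N y) (P.bathVecL N T_L) (P.bathVecR N T_R) ρ x +
    c * ρ x + g x = 0)
  (hvol : ∃ (C : ℝ) (d : ℕ), 0 ≤ C ∧ ∀ R : ℝ, 1 ≤ R →
    (volume {x : PhaseSpace N | P.hamiltonian N x ≤ 4 * R}).toReal ≤ C * R ^ d)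

include hU hV hN hTL hTR hρ hρ0 hρi hg hg0 hgi hpde hvol in
/-- **The truncation family.** Sequences `f_n ∈ C²_c`, `g_n ∈ C_c`, `E_n ∈ C_c` with `0 ≤ f_n ≤ ρ`, `f_n → ρ`,
`0 ≤ g_n ≤ g`, `g_n → g`, `E_n = L̂ f_n + c f_n + g_n` and `∫ |E_n| ≤ 1/(n+1)` (part 4 with `M₀ = R₀ = n`:
eventually `χ(H(x)/R_n) = χ(ρ(x)/M_n) = 1` at every `x`). [folklore] -/
theorem exists_truncationFamily_src (hP : P.IsConfining) :
    ∃ f gs E : ℕ → PhaseSpace N → ℝ,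
      (∀ n, ContDiff ℝ 2 (f n)) ∧ (∀ n, HasCompactSupport (f n)) ∧ (∀ n x, f n x ∈ Icc 0 (ρ x)) ∧
      (∀ x, Tendsto (fun n => f n x) atTop (𝓝 (ρ x))) ∧
      (∀ n, Continuous (gs n)) ∧ (∀ n, HasCompactSupport (gs n)) ∧ (∀ n x, gs n x ∈ Icc 0 (g x)) ∧
      (∀ x, Tendsto (fun n => gs n x) atTop (𝓝 (g x))) ∧
      (∀ n x, E n x = sdeGenerator (fun y => -P.drift N y) (P.bathVecL N T_L) (P.bathVecR N T_R) (f n) x +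
        c * f n x + gs n x) ∧
      (∀ n, Continuous (E n)) ∧ (∀ n, HasCompactSupport (E n)) ∧
      ∀ n, ∫ x, |E n x| ≤ 1 / ((n : ℝ) + 1) := by
  have hU2 : ContDiff ℝ 2 P.U := hU.of_le (by norm_cast)
  have hV2 : ContDiff ℝ 2 P.V := hV.of_le (by norm_cast)
  have hρc : Continuous ρ := hρ.continuous
  have hYc : Continuous fun z => -P.drift N z := (P.contDiff_drift hU hV N).continuous.neg
  have hex : ∀ n : ℕ, ∃ M R : ℝ, (n : ℝ) ≤ M ∧ (n : ℝ) ≤ R ∧ 0 < M ∧ 1 ≤ R ∧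
      ∫ x, |sdeGenerator (fun y => -P.drift N y) (P.bathVecL N T_L) (P.bathVecR N T_R)
            (fun y => smoothCutoff (P.hamiltonian N y / R) * ∫ σ in (0:ℝ)..ρ y, smoothCutoff (σ / M)) x +
          c * (smoothCutoff (P.hamiltonian N x / R) * ∫ σ in (0:ℝ)..ρ x, smoothCutoff (σ / M)) +
          smoothCutoff (P.hamiltonian N x / R) * smoothCutoff (ρ x / M) * g x| ≤ 1 / ((n : ℝ) + 1) := fun n =>
    exists_truncation_defect_le_src hU hV hN hTL hTR hρ hρ0 hρi hg hgi hpde hvol hP (by positivity) n n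
  choose M R hMn hRn hM0 hR1 hdef using hex
  have hR0 : ∀ n, 0 < R n := fun n => by linarith [hR1 n]
  set f : ℕ → PhaseSpace N → ℝ := fun n y =>
    smoothCutoff (P.hamiltonian N y / R n) * ∫ σ in (0:ℝ)..ρ y, smoothCutoff (σ / M n) with hf
  set gs : ℕ → PhaseSpace N → ℝ := fun n x =>
    smoothCutoff (P.hamiltonian N x / R n) * smoothCutoff (ρ x / M n) * g x with hgs
  set E : ℕ → PhaseSpace N → ℝ := fun n x =>
    sdeGenerator (fun y => -P.drift N y) (P.bathVecL N T_L) (P.bathVecR N T_R) (f n) x + c * f n x + gs n x with hE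
  have hf2 : ∀ n, ContDiff ℝ 2 (f n) := fun n => contDiff_truncation hU2 hV2 hρ (M n) (R n)
  have hfc : ∀ n, HasCompactSupport (f n) := fun n => hasCompactSupport_truncation hP (M n) (hR0 n)
  have hfI : ∀ n x, f n x ∈ Icc 0 (ρ x) := fun n x => truncation_mem_Icc hρ0 (M n) (R n) x
  have hflim : ∀ x, Tendsto (fun n => f n x) atTop (𝓝 (ρ x)) := by
    intro x
    refine tendsto_const_nhds.congr' ?_
    obtain ⟨n₀, hn₀⟩ := exists_nat_ge (max (P.hamiltonian N x) (ρ x))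
    filter_upwards [eventually_ge_atTop n₀] with n hn
    have hn' : (n₀ : ℝ) ≤ n := by exact_mod_cast hn
    have h1 : P.hamiltonian N x ≤ R n := by linarith [le_max_left (P.hamiltonian N x) (ρ x), hRn n]
    have h2 : ρ x ≤ M n := by linarith [le_max_right (P.hamiltonian N x) (ρ x), hMn n]
    simp only [hf]
    rw [energyCutoff_eq_one (hR0 n) h1, heightProfile_eq_self (hM0 n) h2, one_mul]
  have hgsc : ∀ n, Continuous (gs n) := fun n =>
    (((contDiff_energyCutoff hU2 hV2 N (R n)).continuous).mul
      ((contDiff_smoothCutoff (n := 0)).continuous.comp (hρc.div_const (M n)))).mul hg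
  have hgscs : ∀ n, HasCompactSupport (gs n) := fun n =>
    (hasCompactSupport_energyCutoff hP N (hR0 n)).mul_right.mul_right
  have hgsI : ∀ n x, gs n x ∈ Icc 0 (g x) := by
    intro n x
    have ha := energyCutoff_mem_Icc (P := P) (R n) x
    have hb0 : 0 ≤ smoothCutoff (ρ x / M n) := smoothCutoff_nonneg _
    have hb1 : smoothCutoff (ρ x / M n) ≤ 1 := smoothCutoff_le_one _
    refine ⟨mul_nonneg (mul_nonneg ha.1 hb0) (hg0 x), ?_⟩
    calc gs n x = (smoothCutoff (P.hamiltonian N x / R n) * smoothCutoff (ρ x / M n)) * g x := rfl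
      _ ≤ 1 * g x := mul_le_mul_of_nonneg_right (mul_le_one₀ ha.2 hb0 hb1) (hg0 x)
      _ = g x := one_mul _
  have hgslim : ∀ x, Tendsto (fun n => gs n x) atTop (𝓝 (g x)) := by
    intro x
    refine tendsto_const_nhds.congr' ?_
    obtain ⟨n₀, hn₀⟩ := exists_nat_ge (max (P.hamiltonian N x) (ρ x))
    filter_upwards [eventually_ge_atTop n₀] with n hn
    have hn' : (n₀ : ℝ) ≤ n := by exact_mod_cast hn
    have h1 : P.hamiltonian N x ≤ R n := by linarith [le_max_left (P.hamiltonian N x) (ρ x), hRn n]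
    have h2 : ρ x ≤ M n := by linarith [le_max_right (P.hamiltonian N x) (ρ x), hMn n]
    simp only [hgs]
    rw [energyCutoff_eq_one (hR0 n) h1, deriv_heightProfile_eq_one (hM0 n) h2, one_mul, one_mul]
  have hEc : ∀ n, Continuous (E n) := fun n =>
    ((continuous_sdeGenerator _ _ hYc (hf2 n)).add (continuous_const.mul (hf2 n).continuous)).add (hgsc n)
  have hEcs : ∀ n, HasCompactSupport (E n) := fun n =>
    ((hasCompactSupport_sdeGenerator _ _ (hfc n)).add ((hfc n).mul_left)).add (hgscs n)
  have hdef' : ∀ n, ∫ x, |E n x| ≤ 1 / ((n : ℝ) + 1) := fun n => hdef n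
  exact ⟨f, gs, E, hf2, hfc, hfI, hflim, hgsc, hgscs, hgsI, hgslim, fun n x => rfl, hEc, hEcs, hdef'⟩

/-- **Duhamel, split into source and defect**: for `f ∈ C²_c`, a bounded continuous `g'`, a real `c`, `t ≥ 0`:
`e^{ct} ∫ f dP̂_t(y,·) + ∫₀ᵗ e^{cs} ∫ g' dP̂_s(y,·) ds = f(y) + ∫₀ᵗ e^{cs} ∫ (L̂ f + c f + g') dP̂_s(y,·) ds`.
[folklore] -/
theorem duhamel_split_src (hP : P.IsConfining) (c : ℝ) {f : PhaseSpace N → ℝ} (hf : ContDiff ℝ 2 f)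
    (hfc : HasCompactSupport f) {g' : PhaseSpace N → ℝ} (hg' : Continuous g') {C' : ℝ} (hC' : ∀ x, ‖g' x‖ ≤ C')
    (t : ℝ≥0) (y : PhaseSpace N) :
    Real.exp (c * t) * (∫ x, f x ∂(P.langevinRevKernel N T_L T_R t y)) +
      (∫ s in (0:ℝ)..(t:ℝ), Real.exp (c * s) * ∫ x, g' x ∂(P.langevinRevKernel N T_L T_R s.toNNReal y)) =
      f y + ∫ s in (0:ℝ)..(t:ℝ), Real.exp (c * s) *
        ∫ x, (sdeGenerator (fun z => -P.drift N z) (P.bathVecL N T_L) (P.bathVecR N T_R) f x + c * f x + g' x)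
          ∂(P.langevinRevKernel N T_L T_R s.toNNReal y) := by
  set κ := P.langevinRevKernel N T_L T_R with hκ
  haveI hprob : ∀ s z, IsProbabilityMeasure (κ s z) := fun s z =>
    isProbabilityMeasure_langevinRevKernel hP N T_L T_R s z
  have hYc : Continuous fun z => -P.drift N z := (hP.reversedDrift N).contDiff_drift.continuous
  have hLfc : Continuous fun x => sdeGenerator (fun z => -P.drift N z) (P.bathVecL N T_L) (P.bathVecR N T_R) f x +
      c * f x := (continuous_sdeGenerator _ _ hYc hf).add (continuous_const.mul hf.continuous)
  obtain ⟨CLf, hCLf⟩ := hLfc.bounded_above_of_compact_support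
    ((hasCompactSupport_sdeGenerator _ _ hfc).add (hfc.mul_left))
  have h := revKernel_duhamel_const T_L T_R hP c hf hfc t y
  have hsplit : ∀ s : ℝ, ∫ x, (sdeGenerator (fun z => -P.drift N z) (P.bathVecL N T_L) (P.bathVecR N T_R) f x +
        c * f x + g' x) ∂(κ s.toNNReal y) =
      (∫ x, (sdeGenerator (fun z => -P.drift N z) (P.bathVecL N T_L) (P.bathVecR N T_R) f x + c * f x)
        ∂(κ s.toNNReal y)) + ∫ x, g' x ∂(κ s.toNNReal y) := by
    intro s
    have i1 : Integrable (fun x => sdeGenerator (fun z => -P.drift N z) (P.bathVecL N T_L) (P.bathVecR N T_R) f x +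
        c * f x) (κ s.toNNReal y) :=
      (integrable_const CLf).mono' hLfc.aestronglyMeasurable (Eventually.of_forall hCLf)
    have i2 : Integrable g' (κ s.toNNReal y) :=
      (integrable_const C').mono' hg'.aestronglyMeasurable (Eventually.of_forall hC')
    exact integral_add i1 i2
  have hI1 := intervalIntegrable_exp_mul_integral_revKernel T_L T_R hP c hLfc hCLf y 0 t
  have hI2 := intervalIntegrable_exp_mul_integral_revKernel T_L T_R hP c hg' hC' y 0 t
  have hsum : ∫ s in (0:ℝ)..(t:ℝ), Real.exp (c * s) *
      ∫ x, (sdeGenerator (fun z => -P.drift N z) (P.bathVecL N T_L) (P.bathVecR N T_R) f x + c * f x + g' x)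
        ∂(κ s.toNNReal y) =
      (∫ s in (0:ℝ)..(t:ℝ), Real.exp (c * s) *
        ∫ x, (sdeGenerator (fun z => -P.drift N z) (P.bathVecL N T_L) (P.bathVecR N T_R) f x + c * f x)
          ∂(κ s.toNNReal y)) +
      ∫ s in (0:ℝ)..(t:ℝ), Real.exp (c * s) * ∫ x, g' x ∂(κ s.toNNReal y) := by
    rw [← intervalIntegral.integral_add hI1 hI2]
    refine intervalIntegral.integral_congr fun s _ => ?_
    simp only [hsplit s]; ring
  rw [hsum, ← h]
  ring

include hU hV hN hTL hTR hρ hρ0 hρi hg hg0 hgi hpde hvol in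
/-- **The setwise resolvent inequality on the reversed side.** For `t > 0` and every set `A`,
`e^{ct} ∫_A (∫ ρ dP̂_t(y,·)) dy + ∫_A ∫_{0<s≤t} ∫ e^{cs} g dP̂_s(y,·) ds dy ≤ ∫_A ρ dy`. [folklore] -/
theorem setLIntegral_revKernel_density_add_le_src (hP : P.IsConfining) (t : ℝ≥0) (A : Set (PhaseSpace N)) :
    (ENNReal.ofReal (Real.exp (c * t)) * ∫⁻ y in A, ∫⁻ x, ENNReal.ofReal (ρ x) ∂(P.langevinRevKernel N T_L T_R t y)) +
      (∫⁻ y in A, ∫⁻ s in Set.Ioc (0 : ℝ) t, ∫⁻ x, ENNReal.ofReal (Real.exp (c * s) * g x)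
        ∂(P.langevinRevKernel N T_L T_R s.toNNReal y)) ≤
      ∫⁻ y in A, ENNReal.ofReal (ρ y) := by
  obtain ⟨f, gs, E, hf2, hfc, hfI, hflim, hgsc, hgscs, hgsI, hgslim, hEdef, hEc, hEcs, hdef⟩ :=
    exists_truncationFamily_src hU hV hN hTL hTR hρ hρ0 hρi hg hg0 hgi hpde hvol hP
  have hρm : Measurable fun x => ENNReal.ofReal (ρ x) := hρ.continuous.measurable.ennreal_ofReal
  have hCg : ∀ n, ∃ C, ∀ x, ‖gs n x‖ ≤ C := fun n => (hgsc n).bounded_above_of_compact_support (hgscs n)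
  choose Cg hCg using hCg
  have hCE : ∀ n, ∃ C, ∀ x, ‖E n x‖ ≤ C := fun n => (hEc n).bounded_above_of_compact_support (hEcs n)
  choose CE hCE using hCE
  -- the integrated defect terms `D n` tend to zero
  obtain ⟨D, hD⟩ : ∃ D : ℕ → ℝ≥0∞, D = fun n => ∫⁻ y, ENNReal.ofReal |∫ s in (0:ℝ)..(t:ℝ), Real.exp (c * s) *
      ∫ x, E n x ∂(P.langevinRevKernel N T_L T_R s.toNNReal y)| := ⟨_, rfl⟩
  have hDle : ∀ n, D n ≤ ENNReal.ofReal (Real.exp (|c| * t)) * t * ENNReal.ofReal (1 / ((n:ℝ) + 1)) := by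
    intro n
    rw [hD]
    refine (lintegral_abs_timeIntegral_revKernel_le T_L T_R hP hU hV hN c (hEc n) (hCE n) t).trans ?_
    refine mul_le_mul_right ?_ _
    have hEi : Integrable fun x => |E n x| := (hEc n).abs.integrable_of_hasCompactSupport (hEcs n).abs
    rw [← ofReal_integral_eq_lintegral_ofReal hEi (Eventually.of_forall fun x => abs_nonneg _)]
    exact ENNReal.ofReal_le_ofReal (hdef n)
  have hDlim : Tendsto D atTop (𝓝 0) := by
    have h0 : Tendsto (fun n : ℕ => ENNReal.ofReal (1 / ((n:ℝ) + 1))) atTop (𝓝 0) := by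
      rw [← ENNReal.ofReal_zero]
      exact ENNReal.tendsto_ofReal tendsto_one_div_add_atTop_nhds_zero_nat
    have h1 : Tendsto (fun n : ℕ => ENNReal.ofReal (Real.exp (|c| * t)) * t * ENNReal.ofReal (1 / ((n:ℝ) + 1)))
        atTop (𝓝 0) := by
      have := ENNReal.Tendsto.const_mul (a := ENNReal.ofReal (Real.exp (|c| * t)) * (t : ℝ≥0∞)) h0
        (Or.inr (ENNReal.mul_ne_top ENNReal.ofReal_ne_top ENNReal.coe_ne_top))
      rwa [mul_zero] at this
    exact tendsto_of_tendsto_of_tendsto_of_le_of_le tendsto_const_nhds h1 (fun n => bot_le) hDle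
  -- the transported functions, as `ℝ≥0∞`-valued functions
  obtain ⟨gn, hgn⟩ : ∃ gn : ℕ → PhaseSpace N → ℝ≥0∞, gn = fun n y =>
      ∫⁻ x, ENNReal.ofReal (Real.exp (c * t) * f n x) ∂(P.langevinRevKernel N T_L T_R t y) := ⟨_, rfl⟩
  obtain ⟨Kn, hKn⟩ : ∃ Kn : ℕ → PhaseSpace N → ℝ → ℝ≥0∞, Kn = fun n y s =>
      ∫⁻ x, ENNReal.ofReal (Real.exp (c * s) * gs n x) ∂(P.langevinRevKernel N T_L T_R s.toNNReal y) := ⟨_, rfl⟩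
  -- measurability
  have hmeas_tk : ∀ {h : PhaseSpace N → ℝ≥0∞}, Measurable h →
      Measurable fun y => ∫⁻ x, h x ∂(P.langevinRevKernel N T_L T_R t y) := by
    intro h hh
    have h1 := measurable_lintegral_revKernel T_L T_R hP hh
    have h2 : Measurable fun y : PhaseSpace N => (y, (t : ℝ)) := measurable_id.prodMk measurable_const
    have h3 := h1.comp h2
    simpa [Function.comp_def, Real.toNNReal_coe] using h3
  have hfm : ∀ n, Measurable fun x => ENNReal.ofReal (Real.exp (c * t) * f n x) := fun n =>
    (continuous_const.mul (hf2 n).continuous).measurable.ennreal_ofReal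
  have hgn_meas : ∀ n, Measurable (gn n) := fun n => by rw [hgn]; exact hmeas_tk (hfm n)
  have hgsm : ∀ n s, Measurable fun x => ENNReal.ofReal (Real.exp (c * s) * gs n x) := fun n s =>
    (continuous_const.mul (hgsc n)).measurable.ennreal_ofReal
  have hexpm : Measurable fun p : PhaseSpace N × ℝ => ENNReal.ofReal (Real.exp (c * p.2)) :=
    (Real.continuous_exp.comp (continuous_const.mul continuous_snd)).measurable.ennreal_ofReal
  have hKn_meas : ∀ n, Measurable fun p : PhaseSpace N × ℝ => Kn n p.1 p.2 := by
    intro n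
    have e : (fun p : PhaseSpace N × ℝ => Kn n p.1 p.2) = fun p => ENNReal.ofReal (Real.exp (c * p.2)) *
        ∫⁻ x, ENNReal.ofReal (gs n x) ∂(P.langevinRevKernel N T_L T_R p.2.toNNReal p.1) := by
      funext p
      rw [hKn]
      dsimp only
      rw [← lintegral_const_mul _ ((hgsc n).measurable.ennreal_ofReal)]
      refine lintegral_congr fun x => ?_
      rw [ENNReal.ofReal_mul (Real.exp_pos _).le]
    rw [e]
    exact hexpm.mul (measurable_lintegral_revKernel T_L T_R hP ((hgsc n).measurable.ennreal_ofReal))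
  have hKn_meas_s : ∀ n y, Measurable fun s => Kn n y s := fun n y =>
    (hKn_meas n).comp (measurable_const.prodMk measurable_id)
  have hYn_meas : ∀ n, Measurable fun y => ∫⁻ s in Set.Ioc (0:ℝ) t, Kn n y s := fun n =>
    (hKn_meas n).lintegral_prod_right
  -- identification with the real quantities
  have hgn_eq : ∀ n y, gn n y = ENNReal.ofReal (Real.exp (c * t) * ∫ x, f n x ∂(P.langevinRevKernel N T_L T_R t y)) := by
    intro n y
    haveI := isProbabilityMeasure_langevinRevKernel hP N T_L T_R t y
    obtain ⟨Cf, hCf⟩ := (hf2 n).continuous.bounded_above_of_compact_support (hfc n)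
    have hint : Integrable (fun x => Real.exp (c * t) * f n x) (P.langevinRevKernel N T_L T_R t y) :=
      ((integrable_const Cf).mono' (hf2 n).continuous.aestronglyMeasurable (Eventually.of_forall hCf)).const_mul _
    rw [hgn, ← integral_const_mul]
    exact (ofReal_integral_eq_lintegral_ofReal hint (Eventually.of_forall fun x =>
      mul_nonneg (Real.exp_pos _).le (hfI n x).1)).symm
  have hKn_real : ∀ n y s, Kn n y s =
      ENNReal.ofReal (Real.exp (c * s) * ∫ x, gs n x ∂(P.langevinRevKernel N T_L T_R s.toNNReal y)) := by
    intro n y s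
    haveI := isProbabilityMeasure_langevinRevKernel hP N T_L T_R s.toNNReal y
    have hint : Integrable (fun x => Real.exp (c * s) * gs n x) (P.langevinRevKernel N T_L T_R s.toNNReal y) :=
      ((integrable_const (Cg n)).mono' (hgsc n).aestronglyMeasurable (Eventually.of_forall (hCg n))).const_mul _
    rw [hKn, ← integral_const_mul]
    exact (ofReal_integral_eq_lintegral_ofReal hint (Eventually.of_forall fun x =>
      mul_nonneg (Real.exp_pos _).le (hgsI n x).1)).symm
  have hYn_eq : ∀ n y, ∫⁻ s in Set.Ioc (0:ℝ) t, Kn n y s = ENNReal.ofReal (∫ s in (0:ℝ)..(t:ℝ), Real.exp (c * s) *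
      ∫ x, gs n x ∂(P.langevinRevKernel N T_L T_R s.toNNReal y)) := by
    intro n y
    have hcs : Continuous fun s : ℝ => Real.exp (c * s) * ∫ x, gs n x ∂(P.langevinRevKernel N T_L T_R s.toNNReal y) :=
      (Real.continuous_exp.comp (continuous_const.mul continuous_id)).mul
        (continuous_integral_langevinRevKernel hP N T_L T_R y (hgsc n) (hCg n))
    have h0 : ∀ s, 0 ≤ Real.exp (c * s) * ∫ x, gs n x ∂(P.langevinRevKernel N T_L T_R s.toNNReal y) := fun s =>
      mul_nonneg (Real.exp_pos _).le (integral_nonneg fun x => (hgsI n x).1)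
    rw [intervalIntegral.integral_of_le t.coe_nonneg, ofReal_integral_eq_lintegral_ofReal
      ((hcs.integrableOn_Icc).mono_set Set.Ioc_subset_Icc_self) (Eventually.of_forall fun s => h0 s)]
    exact lintegral_congr fun s => hKn_real n y s
  -- pointwise: `gn n y + Yn n y ≤ ofReal (f n y) + ofReal |I_E(n, y)|`
  have hpt : ∀ n y, gn n y + ∫⁻ s in Set.Ioc (0:ℝ) t, Kn n y s ≤ ENNReal.ofReal (f n y) +
      ENNReal.ofReal |∫ s in (0:ℝ)..(t:ℝ), Real.exp (c * s) *
        ∫ x, E n x ∂(P.langevinRevKernel N T_L T_R s.toNNReal y)| := by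
    intro n y
    haveI : ∀ s, IsProbabilityMeasure (P.langevinRevKernel N T_L T_R s y) := fun s =>
      isProbabilityMeasure_langevinRevKernel hP N T_L T_R s y
    have hA0 : 0 ≤ Real.exp (c * t) * ∫ x, f n x ∂(P.langevinRevKernel N T_L T_R t y) :=
      mul_nonneg (Real.exp_pos _).le (integral_nonneg fun x => (hfI n x).1)
    have hB0 : 0 ≤ ∫ s in (0:ℝ)..(t:ℝ), Real.exp (c * s) * ∫ x, gs n x ∂(P.langevinRevKernel N T_L T_R s.toNNReal y) :=
      intervalIntegral.integral_nonneg t.coe_nonneg fun s _ =>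
        mul_nonneg (Real.exp_pos _).le (integral_nonneg fun x => (hgsI n x).1)
    have hduh := duhamel_split_src (T_L := T_L) (T_R := T_R) hP c (hf2 n) (hfc n) (hgsc n) (hCg n) t y
    have hE' : (fun s : ℝ => Real.exp (c * s) * ∫ x, (sdeGenerator (fun z => -P.drift N z) (P.bathVecL N T_L)
        (P.bathVecR N T_R) (f n) x + c * f n x + gs n x) ∂(P.langevinRevKernel N T_L T_R s.toNNReal y)) =
        fun s => Real.exp (c * s) * ∫ x, E n x ∂(P.langevinRevKernel N T_L T_R s.toNNReal y) := by
      funext s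
      congr 1
      exact integral_congr_ae (Eventually.of_forall fun x => (hEdef n x).symm)
    rw [hE'] at hduh
    rw [hgn_eq, hYn_eq, ← ENNReal.ofReal_add hA0 hB0, hduh, ← ENNReal.ofReal_add (hfI n y).1 (abs_nonneg _)]
    exact ENNReal.ofReal_le_ofReal (add_le_add le_rfl (le_abs_self _))
  -- integrate over `A`
  have hbound : ∀ n, (∫⁻ y in A, gn n y) + ∫⁻ y in A, ∫⁻ s in Set.Ioc (0:ℝ) t, Kn n y s ≤
      (∫⁻ y in A, ENNReal.ofReal (ρ y)) + D n := by
    intro n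
    rw [← lintegral_add_left (hgn_meas n)]
    calc ∫⁻ y in A, (gn n y + ∫⁻ s in Set.Ioc (0:ℝ) t, Kn n y s)
        ≤ ∫⁻ y in A, (ENNReal.ofReal (f n y) + ENNReal.ofReal |∫ s in (0:ℝ)..(t:ℝ), Real.exp (c * s) *
              ∫ x, E n x ∂(P.langevinRevKernel N T_L T_R s.toNNReal y)|) := lintegral_mono (hpt n)
      _ = (∫⁻ y in A, ENNReal.ofReal (f n y)) + ∫⁻ y in A, ENNReal.ofReal |∫ s in (0:ℝ)..(t:ℝ), Real.exp (c * s) *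
              ∫ x, E n x ∂(P.langevinRevKernel N T_L T_R s.toNNReal y)| :=
          lintegral_add_left ((hf2 n).continuous.measurable.ennreal_ofReal) _
      _ ≤ (∫⁻ y in A, ENNReal.ofReal (ρ y)) + D n := by
          rw [hD]
          refine add_le_add (lintegral_mono fun y => ?_) (setLIntegral_le_lintegral A _)
          exact ENNReal.ofReal_le_ofReal (hfI n y).2
  -- Fatou for the transported truncations
  have hfatou_g : ∫⁻ y in A, ∫⁻ x, ENNReal.ofReal (Real.exp (c * t) * ρ x) ∂(P.langevinRevKernel N T_L T_R t y) ≤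
      liminf (fun n => ∫⁻ y in A, gn n y) atTop := by
    have h1 : ∀ y, ∫⁻ x, ENNReal.ofReal (Real.exp (c * t) * ρ x) ∂(P.langevinRevKernel N T_L T_R t y) ≤
        liminf (fun n => gn n y) atTop := by
      intro y
      have hlim : ∀ x, Tendsto (fun n => ENNReal.ofReal (Real.exp (c * t) * f n x)) atTop
          (𝓝 (ENNReal.ofReal (Real.exp (c * t) * ρ x))) := fun x =>
        ENNReal.tendsto_ofReal ((hflim x).const_mul _)
      rw [hgn]
      calc ∫⁻ x, ENNReal.ofReal (Real.exp (c * t) * ρ x) ∂(P.langevinRevKernel N T_L T_R t y)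
          = ∫⁻ x, liminf (fun n => ENNReal.ofReal (Real.exp (c * t) * f n x)) atTop ∂(P.langevinRevKernel N T_L T_R t y) :=
            lintegral_congr fun x => ((hlim x).liminf_eq).symm
        _ ≤ liminf (fun n => ∫⁻ x, ENNReal.ofReal (Real.exp (c * t) * f n x) ∂(P.langevinRevKernel N T_L T_R t y)) atTop :=
            lintegral_liminf_le hfm
    calc ∫⁻ y in A, ∫⁻ x, ENNReal.ofReal (Real.exp (c * t) * ρ x) ∂(P.langevinRevKernel N T_L T_R t y)
        ≤ ∫⁻ y in A, liminf (fun n => gn n y) atTop := lintegral_mono h1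
      _ ≤ liminf (fun n => ∫⁻ y in A, gn n y) atTop := lintegral_liminf_le hgn_meas
  -- Fatou for the transported sources (three levels)
  have hfatou_Y : ∫⁻ y in A, ∫⁻ s in Set.Ioc (0 : ℝ) t, ∫⁻ x, ENNReal.ofReal (Real.exp (c * s) * g x)
        ∂(P.langevinRevKernel N T_L T_R s.toNNReal y) ≤
      liminf (fun n => ∫⁻ y in A, ∫⁻ s in Set.Ioc (0:ℝ) t, Kn n y s) atTop := by
    have hK : ∀ y s, ∫⁻ x, ENNReal.ofReal (Real.exp (c * s) * g x) ∂(P.langevinRevKernel N T_L T_R s.toNNReal y) ≤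
        liminf (fun n => Kn n y s) atTop := by
      intro y s
      have hlim : ∀ x, Tendsto (fun n => ENNReal.ofReal (Real.exp (c * s) * gs n x)) atTop
          (𝓝 (ENNReal.ofReal (Real.exp (c * s) * g x))) := fun x =>
        ENNReal.tendsto_ofReal ((hgslim x).const_mul _)
      rw [hKn]
      calc ∫⁻ x, ENNReal.ofReal (Real.exp (c * s) * g x) ∂(P.langevinRevKernel N T_L T_R s.toNNReal y)
          = ∫⁻ x, liminf (fun n => ENNReal.ofReal (Real.exp (c * s) * gs n x)) atTop
              ∂(P.langevinRevKernel N T_L T_R s.toNNReal y) := lintegral_congr fun x => ((hlim x).liminf_eq).symm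
        _ ≤ liminf (fun n => ∫⁻ x, ENNReal.ofReal (Real.exp (c * s) * gs n x)
              ∂(P.langevinRevKernel N T_L T_R s.toNNReal y)) atTop := lintegral_liminf_le fun n => hgsm n s
    have hY : ∀ y, ∫⁻ s in Set.Ioc (0 : ℝ) t, ∫⁻ x, ENNReal.ofReal (Real.exp (c * s) * g x)
          ∂(P.langevinRevKernel N T_L T_R s.toNNReal y) ≤
        liminf (fun n => ∫⁻ s in Set.Ioc (0:ℝ) t, Kn n y s) atTop := by
      intro y
      calc ∫⁻ s in Set.Ioc (0 : ℝ) t, ∫⁻ x, ENNReal.ofReal (Real.exp (c * s) * g x)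
            ∂(P.langevinRevKernel N T_L T_R s.toNNReal y)
          ≤ ∫⁻ s in Set.Ioc (0:ℝ) t, liminf (fun n => Kn n y s) atTop := lintegral_mono (hK y)
        _ ≤ liminf (fun n => ∫⁻ s in Set.Ioc (0:ℝ) t, Kn n y s) atTop := lintegral_liminf_le (hKn_meas_s · y)
    calc ∫⁻ y in A, ∫⁻ s in Set.Ioc (0 : ℝ) t, ∫⁻ x, ENNReal.ofReal (Real.exp (c * s) * g x)
          ∂(P.langevinRevKernel N T_L T_R s.toNNReal y)
        ≤ ∫⁻ y in A, liminf (fun n => ∫⁻ s in Set.Ioc (0:ℝ) t, Kn n y s) atTop := lintegral_mono hY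
      _ ≤ liminf (fun n => ∫⁻ y in A, ∫⁻ s in Set.Ioc (0:ℝ) t, Kn n y s) atTop := lintegral_liminf_le hYn_meas
  -- the majorants converge
  have hBlim : Tendsto (fun n => (∫⁻ y in A, ENNReal.ofReal (ρ y)) + D n) atTop (𝓝 (∫⁻ y in A, ENNReal.ofReal (ρ y))) := by
    have h2 := (tendsto_const_nhds (x := ∫⁻ y in A, ENNReal.ofReal (ρ y))).add hDlim
    rwa [add_zero] at h2
  -- combine
  have hglim_eq : ∫⁻ y in A, ∫⁻ x, ENNReal.ofReal (Real.exp (c * t) * ρ x) ∂(P.langevinRevKernel N T_L T_R t y) =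
      ENNReal.ofReal (Real.exp (c * t)) * ∫⁻ y in A, ∫⁻ x, ENNReal.ofReal (ρ x) ∂(P.langevinRevKernel N T_L T_R t y) := by
    rw [← lintegral_const_mul _ (hmeas_tk hρm)]
    refine lintegral_congr fun y => ?_
    rw [← lintegral_const_mul _ hρm]
    refine lintegral_congr fun x => ?_
    rw [ENNReal.ofReal_mul (Real.exp_pos _).le]
  rw [← hglim_eq]
  calc (∫⁻ y in A, ∫⁻ x, ENNReal.ofReal (Real.exp (c * t) * ρ x) ∂(P.langevinRevKernel N T_L T_R t y)) +
        ∫⁻ y in A, ∫⁻ s in Set.Ioc (0 : ℝ) t, ∫⁻ x, ENNReal.ofReal (Real.exp (c * s) * g x)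
          ∂(P.langevinRevKernel N T_L T_R s.toNNReal y)
      ≤ liminf (fun n => ∫⁻ y in A, gn n y) atTop +
          liminf (fun n => ∫⁻ y in A, ∫⁻ s in Set.Ioc (0:ℝ) t, Kn n y s) atTop := add_le_add hfatou_g hfatou_Y
    _ ≤ liminf (fun n => (∫⁻ y in A, gn n y) + ∫⁻ y in A, ∫⁻ s in Set.Ioc (0:ℝ) t, Kn n y s) atTop :=
        Literature.Analysis.FluidPDE.liminf_add_liminf_le_liminf_add _ _
    _ ≤ liminf (fun n => (∫⁻ y in A, ENNReal.ofReal (ρ y)) + D n) atTop :=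
        liminf_le_liminf (Eventually.of_forall fun n => hbound n)
    _ = ∫⁻ y in A, ENNReal.ofReal (ρ y) := hBlim.liminf_eq

end Setwise

/-- Registered helper (notation-free restatement of `setLIntegral_revKernel_density_add_le_src`). -/
theorem helper_flipSetwiseResolventIneq : ∀ (N : ℕ) (P : Literature.MathematicalPhysics.KineticTheory.HeatConduction.OscillatorChain), ContDiff ℝ ((⊤ : ℕ∞) : WithTop ℕ∞) P.U → ContDiff ℝ ((⊤ : ℕ∞) : WithTop ℕ∞) P.V → 0 < N → ∀ (T_L T_R : ℝ), 0 ≤ T_L → 0 ≤ T_R → ∀ (ρ : Literature.MathematicalPhysics.KineticTheory.HeatConduction.PhaseSpace N → ℝ), ContDiff ℝ 2 ρ → (∀ x, 0 ≤ ρ x) → MeasureTheory.Integrable ρ MeasureTheory.volume → ∀ (c : ℝ) (g : Literature.MathematicalPhysics.KineticTheory.HeatConduction.PhaseSpace N → ℝ), Continuous g → (∀ x, 0 ≤ g x) → MeasureTheory.Integrable g MeasureTheory.volume → (∀ x, Literature.MathematicalPhysics.KineticTheory.sdeGenerator (fun y => -P.drift N y) (P.bathVecL N T_L) (P.bathVecR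 N T_R) ρ x + c * ρ x + g x = 0) → (∃ (C : ℝ) (d : ℕ), 0 ≤ C ∧ ∀ R : ℝ, 1 ≤ R → (MeasureTheory.volume {x : Literature.MathematicalPhysics.KineticTheory.HeatConduction.PhaseSpace N | P.hamiltonian N x ≤ 4 * R}).toReal ≤ C * R ^ d) → P.IsConfining → ∀ (t : NNReal) (A : Set (Literature.MathematicalPhysics.KineticTheory.HeatConduction.PhaseSpace N)), ENNReal.ofReal (Real.exp (c * (t : ℝ))) * MeasureTheory.lintegral (MeasureTheory.volume.restrict A) (fun y => MeasureTheory.lintegral (P.langevinRevKernel N T_L T_R t y) (fun x => ENNReal.ofReal (ρ x))) + MeasureTheory.lintegral (MeasureTheory.volume.restrict A) (fun y => MeasureTheory.lintegral (MeasureTheory.volume.restrict (Set.Ioc (0 : ℝ) (t : ℝ))) (fun s => MeasureTheory.lintegral (P.langevinRevKernel N T_L T_R s.toNNReal y) (fun x => ENNReal.ofReal (Real.exp (c * s) * g x)))) ≤ MeasureTheory.lintegral (MeasureTheory.volume.restrict A) (fun y => ENNReal.ofReal (ρ y)) :=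
  fun _ _ hU hV hN _ _ hTL hTR _ hρ hρ0 hρi _ _ hg hg0 hgi hpde hvol hP t A =>
    setLIntegral_revKernel_density_add_le_src hU hV hN hTL hTR hρ hρ0 hρi hg hg0 hgi hpde hvol hP t A

end Summit.AtomisticToContinuum.FouriersLaw.Theorems.NoisyFourier.FlipResolvent

end
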